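import Summits.CriticalPhenomena.PercolationContinuityZ3.Theses.PercNearOneGluing
import Literature.Probability.Percolation.PercolationProofs
import Literature.Probability.Percolation.ConditionalPositiveAssociationProofs
import Literature.Probability.Percolation.TwoClusterConditionalAssociationProofs
import Literature.Probability.Percolation.PercolationEvents
import Literature.Probability.LatticeModels.ProdBernoulliIndependence

/-! TTRL-lite variant V1422 of stmt-CriticalPhenomena-4576 -/

namespace Summit.CriticalPhenomena.PercolationContinuityZ3.Theorems

open MeasureTheory Literature.Probability.LatticeModels Literature.Probability.Percolation
open scoped Classical BigOperators

/-- **Harris for `{o ↔ A}` and `{a₀ ↔ b}`** (TTRL-lite variant V1422 of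
stmt-CriticalPhenomena-4576): under the inhomogeneous product Bernoulli bond measure
`prodBernoulli w` on `Fin n`, the two increasing events `⋃ a ∈ A, {o ↔ a}` and `{a₀ ↔ b}` are
positively correlated. Direct instance of `prodBernoulli_harris` (Harris 1960 / Grimmett 1999,
Thm. (2.4)), both events being increasing (`isUpperSet_openConn`) and measurable
(`measurableSet_openConn_holds`, `Fin n` countable). -/
theorem cp4576_goodstep_var1422 :
    ∀ (n : ℕ) (w : Sym2 (Fin n) → unitInterval) (A : Finset (Fin n)) (o b a₀ : Fin n),
      (prodBernoulli w).real (⋃ a ∈ A, openConn o a) * (prodBernoulli w).real (openConn a₀ b) ≤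
        (prodBernoulli w).real ((⋃ a ∈ A, openConn o a) ∩ openConn a₀ b) := by
  intro n w A o b a₀
  refine prodBernoulli_harris w ?_ (isUpperSet_openConn a₀ b) ?_
    (measurableSet_openConn_holds a₀ b)
  · exact isUpperSet_iUnion₂ fun a _ => isUpperSet_openConn o a
  · exact Finset.measurableSet_biUnion A fun a _ => measurableSet_openConn_holds o a

end Summit.CriticalPhenomena.PercolationContinuityZ3.Theorems
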